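import Summits.QuantumAdvantage.QuantumAdvantage.Theorems.LinnikCubicClassGroupsDegreeOnePrimesEscapeSplittingTypePNTAll
import HarnessLib

/-!
# Splitting-type PNT without exceptional term: Galois closures with no index-two subgroup

Topic `Summits/QuantumAdvantage/QuantumAdvantage/Theorems`, cell B2b-1 (linnik-cubic), PART A (gen 14);
helper toward the crux `DegreeOnePrimesEscape` (stmt-QuantumAdvantage-11543) of route
`LinnikCubicClassGroups`.  HONEST FRAMING: the value of this file is a THEOREM (kernel-checked, GRH-free,
Siegel-free, no hypothesis) — NOT summit progress.

In `splittingType_PNT` the Siegel term is governed by an index-two subgroup `K₁` of `G = Gal(N/ℚ)`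
(Heilbronn–Stark: the exceptional zero of `ζ_N` lives in a quadratic subfield).  If `G` has NO subgroup
of index two — e.g. `|G|` odd — there is no exceptional term at all:

* `splittingType_PNT_of_forall_index_ne_two` — for every number field `K` of degree `n` whose Galois
  closure has no index-two subgroup, every splitting type `T` (full cycle type of some `ψ σ`) and every
  `x ≥ |d_K|^L`: `|#{p ≤ x : splittingType K p = T} − δ_T Li(x)| ≤ ε δ_T Li(x)`, `δ_T = |S_T|/|G|`;
* `splittingType_PNT_of_odd` — the same for every `K` whose Galois closure has odd degree.
[cite: LagariasMontgomeryOdlyzko1979, Theorem 1.1] [cite: Stark1974, Theorem 3]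
-/

noncomputable section

open scoped NumberField nonZeroDivisors
open Finset Real Ideal NumberField
open Literature.NumberTheory.NumberFields Literature.NumberTheory.LFunctions
  Literature.NumberTheory.LFunctions.NumberField

namespace Summit.QuantumAdvantage.QuantumAdvantage.Theorems.DegreeOnePrimesEscape

set_option maxHeartbeats 4000000 in
/-- **Splitting-type PNT in the Linnik range with no exceptional term, for fields whose Galois closure
has no index-two subgroup** (see the module docstring).  Unconditional.
[cite: LagariasMontgomeryOdlyzko1979, Theorem 1.1] [cite: Stark1974, Theorem 3] -/
theorem splittingType_PNT_of_forall_index_ne_two (n : ℕ) [NeZero n] (hn : 1 < n) {ε : ℝ} (hε : 0 < ε)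
    (hε1 : ε ≤ 1) :
    ∃ L : ℝ, 0 < L ∧ ∀ (K : Type) [Field K] [NumberField K], Module.finrank ℚ K = n →
      ∀ (N : Type) [Field N] [NumberField N] [IsGalois ℚ N] (f : K →ₐ[ℚ] N),
        Module.finrank ℚ N ≤ n.factorial →
        (NumberField.discr N).natAbs ≤ (NumberField.discr K).natAbs ^ Module.finrank ℚ N →
        ∀ ψ : (N ≃ₐ[ℚ] N) →* Equiv.Perm (Fin n),
          (∀ g : N ≃ₐ[ℚ] N, g ∈ f.fieldRange.fixingSubgroup ↔ ψ g 0 = 0) →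
          (∀ H : Subgroup (N ≃ₐ[ℚ] N), H.index ≠ 2) →
          ∀ σ : N ≃ₐ[ℚ] N, ∀ x : ℝ, ((NumberField.discr K).natAbs : ℝ) ^ L ≤ x →
            |((((Nat.primesLE ⌊x⌋₊).filter (fun p : ℕ => splittingType K p =
                (ψ σ).cycleType + Multiset.replicate (n - (ψ σ).support.card) 1)).card : ℕ) : ℝ) -
              (Nat.card {g : N ≃ₐ[ℚ] N //
                  (ψ g).cycleType + Multiset.replicate (n - (ψ g).support.card) 1 =
                    (ψ σ).cycleType + Multiset.replicate (n - (ψ σ).support.card) 1} : ℝ) /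
                Nat.card (N ≃ₐ[ℚ] N) * offsetLogIntegral x| ≤
              ε * ((Nat.card {g : N ≃ₐ[ℚ] N //
                  (ψ g).cycleType + Multiset.replicate (n - (ψ g).support.card) 1 =
                    (ψ σ).cycleType + Multiset.replicate (n - (ψ σ).support.card) 1} : ℝ) /
                Nat.card (N ≃ₐ[ℚ] N) * offsetLogIntegral x) := by
  obtain ⟨L, c, hL, -, -, h⟩ := splittingType_PNT n hn hε hε1
  refine ⟨L, hL, fun K _ _ hK N _ _ _ f hNle hdN ψ hstab hno σ x hx => ?_⟩
  obtain ⟨θ, β₁, K₁, hθ, -, -, -, h1, -, hmain⟩ := h K hK N f hNle hdN ψ hstab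
  rcases hθ with hθ0 | hθ1
  · subst hθ0
    have hm := hmain σ x hx
    have e : ((Nat.card {g : N ≃ₐ[ℚ] N //
          (ψ g).cycleType + Multiset.replicate (n - (ψ g).support.card) 1 =
            (ψ σ).cycleType + Multiset.replicate (n - (ψ σ).support.card) 1} : ℝ) *
          offsetLogIntegral x -
        0 * ((Nat.card {g : N ≃ₐ[ℚ] N //
            (ψ g).cycleType + Multiset.replicate (n - (ψ g).support.card) 1 =
              (ψ σ).cycleType + Multiset.replicate (n - (ψ σ).support.card) 1 ∧ g ∈ K₁} : ℝ) -
          Nat.card {g : N ≃ₐ[ℚ] N //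
            (ψ g).cycleType + Multiset.replicate (n - (ψ g).support.card) 1 =
              (ψ σ).cycleType + Multiset.replicate (n - (ψ σ).support.card) 1 ∧ g ∉ K₁}) *
          offsetLogIntegral (x ^ β₁)) / Nat.card (N ≃ₐ[ℚ] N) =
        (Nat.card {g : N ≃ₐ[ℚ] N //
          (ψ g).cycleType + Multiset.replicate (n - (ψ g).support.card) 1 =
            (ψ σ).cycleType + Multiset.replicate (n - (ψ σ).support.card) 1} : ℝ) /
          Nat.card (N ≃ₐ[ℚ] N) * offsetLogIntegral x := by ring
    rw [e] at hm
    exact hm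
  · exact absurd (h1 hθ1).2.1 (hno K₁)

set_option maxHeartbeats 4000000 in
/-- **Splitting-type PNT with no exceptional term for fields with Galois closure of odd degree**: an odd
order group has no index-two subgroup (the index divides the order).  Unconditional.
[cite: LagariasMontgomeryOdlyzko1979, Theorem 1.1] -/
theorem splittingType_PNT_of_odd (n : ℕ) [NeZero n] (hn : 1 < n) {ε : ℝ} (hε : 0 < ε) (hε1 : ε ≤ 1) :
    ∃ L : ℝ, 0 < L ∧ ∀ (K : Type) [Field K] [NumberField K], Module.finrank ℚ K = n →
      ∀ (N : Type) [Field N] [NumberField N] [IsGalois ℚ N] (f : K →ₐ[ℚ] N),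
        Module.finrank ℚ N ≤ n.factorial →
        (NumberField.discr N).natAbs ≤ (NumberField.discr K).natAbs ^ Module.finrank ℚ N →
        Odd (Module.finrank ℚ N) →
        ∀ ψ : (N ≃ₐ[ℚ] N) →* Equiv.Perm (Fin n),
          (∀ g : N ≃ₐ[ℚ] N, g ∈ f.fieldRange.fixingSubgroup ↔ ψ g 0 = 0) →
          ∀ σ : N ≃ₐ[ℚ] N, ∀ x : ℝ, ((NumberField.discr K).natAbs : ℝ) ^ L ≤ x →
            |((((Nat.primesLE ⌊x⌋₊).filter (fun p : ℕ => splittingType K p =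
                (ψ σ).cycleType + Multiset.replicate (n - (ψ σ).support.card) 1)).card : ℕ) : ℝ) -
              (Nat.card {g : N ≃ₐ[ℚ] N //
                  (ψ g).cycleType + Multiset.replicate (n - (ψ g).support.card) 1 =
                    (ψ σ).cycleType + Multiset.replicate (n - (ψ σ).support.card) 1} : ℝ) /
                Nat.card (N ≃ₐ[ℚ] N) * offsetLogIntegral x| ≤
              ε * ((Nat.card {g : N ≃ₐ[ℚ] N //
                  (ψ g).cycleType + Multiset.replicate (n - (ψ g).support.card) 1 =
                    (ψ σ).cycleType + Multiset.replicate (n - (ψ σ).support.card) 1} : ℝ) /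
                Nat.card (N ≃ₐ[ℚ] N) * offsetLogIntegral x) := by
  obtain ⟨L, hL, h⟩ := splittingType_PNT_of_forall_index_ne_two n hn hε hε1
  refine ⟨L, hL, fun K _ _ hK N _ _ _ f hNle hdN hodd ψ hstab σ x hx => ?_⟩
  refine h K hK N f hNle hdN ψ hstab (fun H hH => ?_) σ x hx
  have hdvd : H.index ∣ Nat.card (N ≃ₐ[ℚ] N) := H.index_dvd_card
  rw [IsGalois.card_aut_eq_finrank, hH] at hdvd
  exact (Nat.not_even_iff_odd.mpr hodd) (even_iff_two_dvd.mpr hdvd)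

end Summit.QuantumAdvantage.QuantumAdvantage.Theorems.DegreeOnePrimesEscape

end
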